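import Literature.NumberTheory.Automorphic.UnitaryGroupRationalLeviDecomposition
import Literature.NumberTheory.Automorphic.UnitaryGroupBorelTorusUnipotentCoordinates
import Literature.NumberTheory.Automorphic.UnitaryGroupBorelSiegelSet
import Literature.MeasureTheory.Group.CoveringWeights
import HarnessLib

/-!
# Covering weights for the rational Borel subgroup of `U(J_N)` and the product weight `w_N · w_T`
(Arthur, *A trace formula for reductive groups I*, Duke Math. J. 45 (1978), §1 and §8: unfolding
`∫_{P(F)\G(𝔸)} = ∫_K ∫_{M(F)\M(𝔸)} ∫_{N(F)\N(𝔸)}`; Rogawski, *Automorphic Representations of Unitary Groups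
in Three Variables* (1990), §1.10 `B = MN`, §2.2 p. 13; Bourbaki, *Intégration* VII §2 no. 4 (smooth
fundamental domains).)

Topic `NumberTheory/Automorphic`; namespace `Literature.NumberTheory.Automorphic.UnitaryGroup`. THEOREMS
ONLY over accepted tree modules: no definition, no named fact, no instance, no notation, no `sorry`.
Row (L2-w) «RATIONAL BOREL COVERING WEIGHTS» of the T1-qs LAW 2 road (`UnitaryGroup.TruncatedTracePolynomial`,
`J^T(f) = a + b log T`) of the engine line `Cruxes/H413/Lines/F0_T1InnerFormTraceIdentity.lean` (F0P3a-p04 (g5)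
WORDS #2 (4)): the plumbing every unfolding step of the road imports.

Setting: Mok's `U_{E/F}(N) = U(J_N)` (★ `quasiSplit F E c N`), its adelic Borel subgroup
`B(𝔸_F) = T(𝔸_F) ⋉ N(𝔸_F)` (★ `borelAdelic`, ★ `torusInBorel`, ★ `unipotentInBorel`, ★ `torusPart`), the
arithmetic subgroup `G(F)` (★ `arithmeticSubgroup`, discrete: ★ `isDiscreteRational_quasiSplit`), and the
covering weights of ★ `Literature.MeasureTheory.Group.CoveringWeights` (`IsCoveringWeight Γ β`:
`β` measurable and `Σ'_{γ ∈ Γ} β(γ • x) = 1`, for a subgroup acting by LEFT multiplication). The four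
rational groups of the road, IN THEIR AMBIENTS (letters of the LAW2-SPEC):

* `B(F)♯ := (arithmeticBorel F E c N).map (quasiSplit F E c N).arithmeticSubgroup.subtype ≤ G(𝔸_F)`,
* `B(F)_B := ((quasiSplit F E c N).arithmeticSubgroup).subgroupOf (borelAdelic F E c N) ≤ B(𝔸_F)`
  (this is ★ `rationalBorel F E c N`, definitionally),
* `T(F)_T := B(F)_B.subgroupOf (torusInBorel F E c N) ≤ T(𝔸_F)`,
* `N(F)_N := B(F)_B.subgroupOf (unipotentInBorel F E c N) ≤ N(𝔸_F)`.

Results (all `N`, all `(F, E, c)`):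
* §1 (w1) the four rational groups are DISCRETE in their ambients (continuous injections into the discrete
  `G(F)`): `discreteTopology_arithmeticBorel_map`, `…_arithmeticSubgroup_subgroupOf_borelAdelic`,
  `…_subgroupOf_torusInBorel`, `…_subgroupOf_unipotentInBorel`.
* §2 (w2) covering weights EXIST for each (★ `exists_isCoveringWeight`; `B(𝔸_F)`, `T(𝔸_F)`, `N(𝔸_F)` are
  second countable Borel groups, ★ `secondCountableTopology_borelAdelic`): `exists_isCoveringWeight_arithmeticBorel_map`,
  `…_borelAdelic`, `…_torusInBorel`, `…_unipotentInBorel`; and STRICT measurable fundamental sets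
  (`∀ n, ∃! ν ∈ N(F), ν n ∈ Ω`, ★ `Subgroup.exists_measurableSet_existsUnique_smul_mem`):
  `exists_measurableSet_existsUnique_smul_mem_unipotentInBorel` (resp. `…_torusInBorel`).
* §3 the rational Levi decomposition in this currency: `exists_equiv_subgroupOf_torus_prod_unipotent`, a
  bijection `e : T(F)_T × N(F)_N ≃ B(F)_B` with `e (τ, ν) = ν τ` (order `n · t`; ★ `torusPart_mem_arithmeticSubgroup`).
* §4 (w3) **`isCoveringWeight_borel_of_unipotent_of_torus`** — THE PRODUCT WEIGHT: for ANY covering weights `w_N`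
  of `N(F)_N` on `N(𝔸_F)` and `w_T` of `T(F)_T` on `T(𝔸_F)`, `w(b) := w_N(b (torusPart b)⁻¹) · w_T(torusPart b)` is a
  covering weight of `B(F)_B` on `B(𝔸_F)`: for `β = ν τ`, `w(ν τ b) = w_N(ν · τ n_b τ⁻¹) · w_T(τ t_b)`
  (`t_b = torusPart b`, `n_b = b t_b⁻¹`), so `Σ_β w(β b) = Σ_τ w_T(τ t_b) · Σ_ν w_N(ν · (τ n_b τ⁻¹)) = 1`;
  corollaries `isCoveringWeight_borel_indicator_mul` (`w_N = 1_Ω`, the letter of WORDS #2 (4)) and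
  `exists_isCoveringWeight_borel_indicator_mul` (existence of the package `(Ω, w_T, w)`). (The transfer
  «`β(· g)|_{B(𝔸_F)}` is a `B(F)_B`-weight» of the Iwasawa step (L2-i) lives in ★ `UnitaryGroupIwasawaWeightExchange`.)

## References
* J. Arthur, *A trace formula for reductive groups I: terms associated to classes in `G(ℚ)`*, Duke Math. J.
  45 (1978), §1, §8 [Arthur1978TraceFormulaI].
* J. D. Rogawski, *Automorphic Representations of Unitary Groups in Three Variables*, Ann. of Math. Stud. 123
  (1990), §1.10, §2.2 [Rogawski1990].
* N. Bourbaki, *Intégration*, Ch. VII §2 no. 4 [BourbakiIntegrationVII].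
-/

set_option autoImplicit false

noncomputable section

open MeasureTheory NumberField IsDedekindDomain Topology Set Literature.MeasureTheory.Group
open scoped ENNReal NNReal Pointwise

namespace Literature.NumberTheory.Automorphic

namespace UnitaryGroup

variable {F E : Type} [Field F] [NumberField F] [Field E] [NumberField E] [Algebra F E]
  {c : E ≃ₐ[F] E} {N : ℕ}

/-! ## §0 Plumbing: the ambient instances (transported, as in ★ `UnitaryGroupBorelSemidirect`) -/

/-- `U(J_N)(𝔸_F)` is second countable (instance of ★ `UnitaryGroupOfFormAdelicTopology`, transported to the
datum's carrier). [folklore] -/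
private theorem secondCountableTopology_quasiSplit_adelic'' : SecondCountableTopology (quasiSplit F E c N).Adelic :=
  inferInstanceAs (SecondCountableTopology (adelic F E c N ((StdForm.antidiagonal N).over E)))

/-- `G(F)` is discrete in `G(𝔸_F)` (instance form of ★ `isDiscreteRational_quasiSplit`). [cite: Borel1963, §5] -/
private theorem discreteTopology_arithmeticSubgroup' : DiscreteTopology (quasiSplit F E c N).arithmeticSubgroup :=
  isDiscreteRational_quasiSplit

/-! ## §1 (w1) The four rational groups are discrete in their ambients -/

/-- **`B(F)♯ ≤ G(𝔸_F)` is discrete**: it is contained in the discrete `G(F)` (★ `isDiscreteRational_quasiSplit`).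
[cite: Borel1963, §5] -/
theorem discreteTopology_arithmeticBorel_map :
    DiscreteTopology ((arithmeticBorel F E c N).map (quasiSplit F E c N).arithmeticSubgroup.subtype) := by
  haveI := discreteTopology_arithmeticSubgroup' (F := F) (E := E) (c := c) (N := N)
  refine DiscreteTopology.of_continuous_injective
    (f := fun γ : (arithmeticBorel F E c N).map (quasiSplit F E c N).arithmeticSubgroup.subtype =>
      (⟨(γ : (quasiSplit F E c N).Adelic), Subgroup.map_subtype_le _ γ.2⟩ : (quasiSplit F E c N).arithmeticSubgroup))
    (continuous_subtype_val.subtype_mk _) ?_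
  intro a b h
  simp only [Subtype.mk.injEq] at h
  exact Subtype.ext h

/-- **`B(F)_B ≤ B(𝔸_F)` is discrete** (continuous injection `b ↦ b` into the discrete `G(F)`).
[cite: Borel1963, §5] -/
theorem discreteTopology_arithmeticSubgroup_subgroupOf_borelAdelic :
    DiscreteTopology (((quasiSplit F E c N).arithmeticSubgroup).subgroupOf (borelAdelic F E c N)) := by
  haveI := discreteTopology_arithmeticSubgroup' (F := F) (E := E) (c := c) (N := N)
  refine DiscreteTopology.of_continuous_injective
    (f := fun β : ((quasiSplit F E c N).arithmeticSubgroup).subgroupOf (borelAdelic F E c N) =>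
      (⟨((β : borelAdelic F E c N) : (quasiSplit F E c N).Adelic), Subgroup.mem_subgroupOf.1 β.2⟩ :
        (quasiSplit F E c N).arithmeticSubgroup))
    ((continuous_subtype_val.comp continuous_subtype_val).subtype_mk _) ?_
  intro a b h
  simp only [Subtype.mk.injEq] at h
  exact Subtype.ext (Subtype.ext h)

/-- **`T(F)_T ≤ T(𝔸_F)` is discrete.** [cite: Borel1963, §5] -/
theorem discreteTopology_subgroupOf_torusInBorel :
    DiscreteTopology ((((quasiSplit F E c N).arithmeticSubgroup).subgroupOf (borelAdelic F E c N)).subgroupOf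
      (torusInBorel F E c N)) := by
  haveI := discreteTopology_arithmeticSubgroup' (F := F) (E := E) (c := c) (N := N)
  refine DiscreteTopology.of_continuous_injective
    (f := fun τ : (((quasiSplit F E c N).arithmeticSubgroup).subgroupOf (borelAdelic F E c N)).subgroupOf
        (torusInBorel F E c N) =>
      (⟨(((τ : torusInBorel F E c N) : borelAdelic F E c N) : (quasiSplit F E c N).Adelic),
        Subgroup.mem_subgroupOf.1 (Subgroup.mem_subgroupOf.1 τ.2)⟩ : (quasiSplit F E c N).arithmeticSubgroup))
    (((continuous_subtype_val.comp continuous_subtype_val).comp continuous_subtype_val).subtype_mk _) ?_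
  intro a b h
  simp only [Subtype.mk.injEq] at h
  exact Subtype.ext (Subtype.ext (Subtype.ext h))

/-- **`N(F)_N ≤ N(𝔸_F)` is discrete.** [cite: Borel1963, §5] -/
theorem discreteTopology_subgroupOf_unipotentInBorel :
    DiscreteTopology ((((quasiSplit F E c N).arithmeticSubgroup).subgroupOf (borelAdelic F E c N)).subgroupOf
      (unipotentInBorel F E c N)) := by
  haveI := discreteTopology_arithmeticSubgroup' (F := F) (E := E) (c := c) (N := N)
  refine DiscreteTopology.of_continuous_injective
    (f := fun ν : (((quasiSplit F E c N).arithmeticSubgroup).subgroupOf (borelAdelic F E c N)).subgroupOf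
        (unipotentInBorel F E c N) =>
      (⟨(((ν : unipotentInBorel F E c N) : borelAdelic F E c N) : (quasiSplit F E c N).Adelic),
        Subgroup.mem_subgroupOf.1 (Subgroup.mem_subgroupOf.1 ν.2)⟩ : (quasiSplit F E c N).arithmeticSubgroup))
    (((continuous_subtype_val.comp continuous_subtype_val).comp continuous_subtype_val).subtype_mk _) ?_
  intro a b h
  simp only [Subtype.mk.injEq] at h
  exact Subtype.ext (Subtype.ext (Subtype.ext h))

/-! ## §2 (w2) Existence of covering weights and of strict fundamental sets -/

section Existence

variable [MeasurableSpace (quasiSplit F E c N).Adelic] [BorelSpace (quasiSplit F E c N).Adelic]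

/-- **A covering weight of `B(F)♯` on `G(𝔸_F)` exists** (★ `exists_isCoveringWeight`: `G(𝔸_F)` is a second
countable Borel group and `B(F)♯` is discrete). [cite: Arthur1978TraceFormulaI, §1] -/
theorem exists_isCoveringWeight_arithmeticBorel_map :
    ∃ β : (quasiSplit F E c N).Adelic → ℝ≥0∞,
      IsCoveringWeight ((arithmeticBorel F E c N).map (quasiSplit F E c N).arithmeticSubgroup.subtype) β := by
  haveI := secondCountableTopology_quasiSplit_adelic'' (F := F) (E := E) (c := c) (N := N)
  haveI := discreteTopology_arithmeticBorel_map (F := F) (E := E) (c := c) (N := N)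
  exact exists_isCoveringWeight _

/-- **A covering weight of `B(F)_B` on `B(𝔸_F)` exists.** [cite: Arthur1978TraceFormulaI, §1] -/
theorem exists_isCoveringWeight_borelAdelic :
    ∃ w : borelAdelic F E c N → ℝ≥0∞,
      IsCoveringWeight (((quasiSplit F E c N).arithmeticSubgroup).subgroupOf (borelAdelic F E c N)) w := by
  haveI : SecondCountableTopology (borelAdelic F E c N) := secondCountableTopology_borelAdelic
  haveI := discreteTopology_arithmeticSubgroup_subgroupOf_borelAdelic (F := F) (E := E) (c := c) (N := N)
  exact exists_isCoveringWeight _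

/-- **A covering weight of `T(F)_T` on `T(𝔸_F)` exists.** [cite: Arthur1978TraceFormulaI, §1] -/
theorem exists_isCoveringWeight_torusInBorel :
    ∃ wT : torusInBorel F E c N → ℝ≥0∞,
      IsCoveringWeight ((((quasiSplit F E c N).arithmeticSubgroup).subgroupOf (borelAdelic F E c N)).subgroupOf
        (torusInBorel F E c N)) wT := by
  haveI : SecondCountableTopology (borelAdelic F E c N) := secondCountableTopology_borelAdelic
  haveI : SecondCountableTopology (torusInBorel F E c N) := TopologicalSpace.Subtype.secondCountableTopology _
  haveI := discreteTopology_subgroupOf_torusInBorel (F := F) (E := E) (c := c) (N := N)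
  exact exists_isCoveringWeight _

/-- **A covering weight of `N(F)_N` on `N(𝔸_F)` exists.** [cite: Arthur1978TraceFormulaI, §1] -/
theorem exists_isCoveringWeight_unipotentInBorel :
    ∃ wN : unipotentInBorel F E c N → ℝ≥0∞,
      IsCoveringWeight ((((quasiSplit F E c N).arithmeticSubgroup).subgroupOf (borelAdelic F E c N)).subgroupOf
        (unipotentInBorel F E c N)) wN := by
  haveI : SecondCountableTopology (borelAdelic F E c N) := secondCountableTopology_borelAdelic
  haveI : SecondCountableTopology (unipotentInBorel F E c N) := TopologicalSpace.Subtype.secondCountableTopology _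
  haveI := discreteTopology_subgroupOf_unipotentInBorel (F := F) (E := E) (c := c) (N := N)
  exact exists_isCoveringWeight _

/-- **A strict measurable fundamental set `Ω ⊆ N(𝔸_F)` for `N(F)`**: `∀ n, ∃! ν ∈ N(F)_N, ν n ∈ Ω`
(★ `Subgroup.exists_measurableSet_existsUnique_smul_mem`). [cite: Arthur1978TraceFormulaI, §1] -/
theorem exists_measurableSet_existsUnique_smul_mem_unipotentInBorel :
    ∃ Ω : Set (unipotentInBorel F E c N), MeasurableSet Ω ∧
      ∀ n : unipotentInBorel F E c N,
        ∃! ν : (((quasiSplit F E c N).arithmeticSubgroup).subgroupOf (borelAdelic F E c N)).subgroupOf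
          (unipotentInBorel F E c N), ν • n ∈ Ω := by
  haveI : SecondCountableTopology (borelAdelic F E c N) := secondCountableTopology_borelAdelic
  haveI : SecondCountableTopology (unipotentInBorel F E c N) := TopologicalSpace.Subtype.secondCountableTopology _
  haveI := discreteTopology_subgroupOf_unipotentInBorel (F := F) (E := E) (c := c) (N := N)
  exact Subgroup.exists_measurableSet_existsUnique_smul_mem _

/-- A strict measurable fundamental set for `T(F)_T` on `T(𝔸_F)`. [cite: Arthur1978TraceFormulaI, §1] -/
theorem exists_measurableSet_existsUnique_smul_mem_torusInBorel :
    ∃ Ω : Set (torusInBorel F E c N), MeasurableSet Ω ∧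
      ∀ t : torusInBorel F E c N,
        ∃! τ : (((quasiSplit F E c N).arithmeticSubgroup).subgroupOf (borelAdelic F E c N)).subgroupOf
          (torusInBorel F E c N), τ • t ∈ Ω := by
  haveI : SecondCountableTopology (borelAdelic F E c N) := secondCountableTopology_borelAdelic
  haveI : SecondCountableTopology (torusInBorel F E c N) := TopologicalSpace.Subtype.secondCountableTopology _
  haveI := discreteTopology_subgroupOf_torusInBorel (F := F) (E := E) (c := c) (N := N)
  exact Subgroup.exists_measurableSet_existsUnique_smul_mem _

end Existence

/-! ## §3 The rational Levi decomposition `B(F)_B = N(F)_N · T(F)_T` (order `n · t`) -/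

/-- `torusPart (n t) = t` for `n ∈ N(𝔸_F)`, `t ∈ T(𝔸_F)`. [cite: Rogawski1990, §1.10] -/
theorem torusPart_unipotent_mul_torus (n : unipotentInBorel F E c N) (t : torusInBorel F E c N) :
    torusPart ((n : borelAdelic F E c N) * (t : borelAdelic F E c N)) = (t : borelAdelic F E c N) := by
  rw [torusPart_mul, torusPart_eq_one_of_mem n.2, one_mul, torusPart_eq_self_of_mem t.2]

/-- The torus part of an element of `B(F)_B` lies in `T(F)_T` (★ `torusPart_mem_arithmeticSubgroup`).
[cite: Rogawski1990, §1.10] -/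
theorem torusPart_mem_subgroupOf_torusInBorel {β : borelAdelic F E c N}
    (hβ : β ∈ ((quasiSplit F E c N).arithmeticSubgroup).subgroupOf (borelAdelic F E c N)) :
    (⟨torusPart β, torusPart_mem_torusAdelic β⟩ : torusInBorel F E c N) ∈
      (((quasiSplit F E c N).arithmeticSubgroup).subgroupOf (borelAdelic F E c N)).subgroupOf
        (torusInBorel F E c N) :=
  Subgroup.mem_subgroupOf.2 (Subgroup.mem_subgroupOf.2 (torusPart_mem_arithmeticSubgroup (Subgroup.mem_subgroupOf.1 hβ)))

/-- The (left) unipotent part `β (torusPart β)⁻¹` of an element of `B(F)_B` lies in `N(F)_N`.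
[cite: Rogawski1990, §1.10] -/
theorem mul_torusPart_inv_mem_subgroupOf_unipotentInBorel {β : borelAdelic F E c N}
    (hβ : β ∈ ((quasiSplit F E c N).arithmeticSubgroup).subgroupOf (borelAdelic F E c N)) :
    (⟨β * (torusPart β)⁻¹, mul_torusPart_inv_mem_unipotentInBorel β⟩ : unipotentInBorel F E c N) ∈
      (((quasiSplit F E c N).arithmeticSubgroup).subgroupOf (borelAdelic F E c N)).subgroupOf
        (unipotentInBorel F E c N) := by
  refine Subgroup.mem_subgroupOf.2 (Subgroup.mem_subgroupOf.2 ?_)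
  change ((β * (torusPart β)⁻¹ : borelAdelic F E c N) : (quasiSplit F E c N).Adelic) ∈
    (quasiSplit F E c N).arithmeticSubgroup
  rw [Subgroup.coe_mul, Subgroup.coe_inv]
  exact Subgroup.mul_mem _ (Subgroup.mem_subgroupOf.1 hβ)
    (Subgroup.inv_mem _ (torusPart_mem_arithmeticSubgroup (Subgroup.mem_subgroupOf.1 hβ)))

/-- **`B(F)_B = N(F)_N · T(F)_T` with uniqueness**: a bijection `e : T(F)_T × N(F)_N ≃ B(F)_B` with
`e (τ, ν) = ν τ` in `B(𝔸_F)`. [cite: Rogawski1990, §1.10] -/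
theorem exists_equiv_subgroupOf_torus_prod_unipotent :
    ∃ e : (((quasiSplit F E c N).arithmeticSubgroup).subgroupOf (borelAdelic F E c N)).subgroupOf
            (torusInBorel F E c N) ×
          (((quasiSplit F E c N).arithmeticSubgroup).subgroupOf (borelAdelic F E c N)).subgroupOf
            (unipotentInBorel F E c N) ≃
        ((quasiSplit F E c N).arithmeticSubgroup).subgroupOf (borelAdelic F E c N),
      ∀ p, ((e p : ((quasiSplit F E c N).arithmeticSubgroup).subgroupOf (borelAdelic F E c N)) :
          borelAdelic F E c N) =
        ((p.2 : unipotentInBorel F E c N) : borelAdelic F E c N) * ((p.1 : torusInBorel F E c N) : borelAdelic F E c N) := by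
  -- the multiplication map `(τ, ν) ↦ ν τ`
  let m : (((quasiSplit F E c N).arithmeticSubgroup).subgroupOf (borelAdelic F E c N)).subgroupOf
            (torusInBorel F E c N) ×
          (((quasiSplit F E c N).arithmeticSubgroup).subgroupOf (borelAdelic F E c N)).subgroupOf
            (unipotentInBorel F E c N) →
        ((quasiSplit F E c N).arithmeticSubgroup).subgroupOf (borelAdelic F E c N) := fun p =>
    ⟨((p.2 : unipotentInBorel F E c N) : borelAdelic F E c N) * ((p.1 : torusInBorel F E c N) : borelAdelic F E c N),
      Subgroup.mul_mem _ (Subgroup.mem_subgroupOf.1 p.2.2) (Subgroup.mem_subgroupOf.1 p.1.2)⟩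
  refine ⟨Equiv.ofBijective m ⟨?_, ?_⟩, fun p => rfl⟩
  · -- injective: torus parts agree, then cancel
    rintro ⟨τ, ν⟩ ⟨τ', ν'⟩ h
    have h1 : ((ν : unipotentInBorel F E c N) : borelAdelic F E c N) * ((τ : torusInBorel F E c N) : borelAdelic F E c N) =
        ((ν' : unipotentInBorel F E c N) : borelAdelic F E c N) * ((τ' : torusInBorel F E c N) : borelAdelic F E c N) :=
      congrArg Subtype.val h
    have ht : ((τ : torusInBorel F E c N) : borelAdelic F E c N) = ((τ' : torusInBorel F E c N) : borelAdelic F E c N) := by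
      rw [← torusPart_unipotent_mul_torus (ν : unipotentInBorel F E c N) (τ : torusInBorel F E c N), h1,
        torusPart_unipotent_mul_torus]
    have hn : ((ν : unipotentInBorel F E c N) : borelAdelic F E c N) = ((ν' : unipotentInBorel F E c N) : borelAdelic F E c N) := by
      rw [ht] at h1
      exact mul_right_cancel h1
    exact Prod.ext (Subtype.ext (Subtype.ext ht)) (Subtype.ext (Subtype.ext hn))
  · -- surjective: `β = (β t⁻¹) · t`, `t = torusPart β`
    intro β
    refine ⟨(⟨⟨torusPart (β : borelAdelic F E c N), torusPart_mem_torusAdelic _⟩, torusPart_mem_subgroupOf_torusInBorel β.2⟩,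
      ⟨⟨(β : borelAdelic F E c N) * (torusPart (β : borelAdelic F E c N))⁻¹, mul_torusPart_inv_mem_unipotentInBorel _⟩,
        mul_torusPart_inv_mem_subgroupOf_unipotentInBorel β.2⟩), Subtype.ext ?_⟩
    change (β : borelAdelic F E c N) * (torusPart (β : borelAdelic F E c N))⁻¹ * torusPart (β : borelAdelic F E c N) =
      (β : borelAdelic F E c N)
    rw [inv_mul_cancel_right]

/-! ## §4 (w3) The product weight `w(b) = w_N(b (torusPart b)⁻¹) · w_T(torusPart b)` -/

/-- **The product weight at `ν τ b`** (`ν ∈ N(𝔸_F)`, `τ ∈ T(𝔸_F)`): with `t = torusPart b`, `n = b t⁻¹`,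
`torusPart (ν τ b) = τ t` and `(ν τ b)(torusPart (ν τ b))⁻¹ = ν · (τ n τ⁻¹)`, hence
`w(ν τ b) = w_N(ν · (τ n τ⁻¹)) · w_T(τ t)`. [cite: Rogawski1990, §1.10] -/
theorem productWeight_apply_unipotent_mul_torus_mul (wN : unipotentInBorel F E c N → ℝ≥0∞)
    (wT : torusInBorel F E c N → ℝ≥0∞) (ν : unipotentInBorel F E c N) (τ : torusInBorel F E c N)
    (b : borelAdelic F E c N) :
    wN ⟨(ν : borelAdelic F E c N) * (τ : borelAdelic F E c N) * b *
          (torusPart ((ν : borelAdelic F E c N) * (τ : borelAdelic F E c N) * b))⁻¹,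
        mul_torusPart_inv_mem_unipotentInBorel _⟩ *
      wT ⟨torusPart ((ν : borelAdelic F E c N) * (τ : borelAdelic F E c N) * b), torusPart_mem_torusAdelic _⟩ =
    wN (ν * ⟨(τ : borelAdelic F E c N) * (b * (torusPart b)⁻¹) * (τ : borelAdelic F E c N)⁻¹,
        mul_mul_inv_mem_unipotentInBorel _ (mul_torusPart_inv_mem_unipotentInBorel b)⟩) *
      wT (τ * ⟨torusPart b, torusPart_mem_torusAdelic b⟩) := by
  have ht : torusPart ((ν : borelAdelic F E c N) * (τ : borelAdelic F E c N) * b) =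
      (τ : borelAdelic F E c N) * torusPart b := by
    rw [torusPart_mul, torusPart_unipotent_mul_torus]
  congr 1
  · congr 1
    refine Subtype.ext ?_
    change (ν : borelAdelic F E c N) * (τ : borelAdelic F E c N) * b *
        (torusPart ((ν : borelAdelic F E c N) * (τ : borelAdelic F E c N) * b))⁻¹ =
      (ν : borelAdelic F E c N) * ((τ : borelAdelic F E c N) * (b * (torusPart b)⁻¹) * (τ : borelAdelic F E c N)⁻¹)
    rw [ht, mul_inv_rev]
    simp only [mul_assoc]
  · congr 1
    exact Subtype.ext ht

section ProductWeight

variable [MeasurableSpace (quasiSplit F E c N).Adelic] [BorelSpace (quasiSplit F E c N).Adelic]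

/-- `b ↦ b (torusPart b)⁻¹ ∈ N(𝔸_F)` is measurable (continuous, ★ `continuous_torusPart`). [cite: Rogawski1990, §1.10] -/
theorem measurable_mul_torusPart_inv :
    Measurable fun b : borelAdelic F E c N =>
      (⟨b * (torusPart b)⁻¹, mul_torusPart_inv_mem_unipotentInBorel b⟩ : unipotentInBorel F E c N) :=
  ((continuous_id.mul continuous_torusPart.inv).subtype_mk _).measurable

/-- `b ↦ torusPart b ∈ T(𝔸_F)` is measurable (continuous, ★ `continuous_torusPart`). [cite: Rogawski1990, §1.10] -/
theorem measurable_torusPart_mk :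
    Measurable fun b : borelAdelic F E c N => (⟨torusPart b, torusPart_mem_torusAdelic b⟩ : torusInBorel F E c N) :=
  (continuous_torusPart.subtype_mk _).measurable

/-- **THE PRODUCT WEIGHT (row (L2-w) (w3)).**  For ANY covering weight `w_N` of `N(F)_N` on `N(𝔸_F)` and ANY
covering weight `w_T` of `T(F)_T` on `T(𝔸_F)`, the function `w(b) := w_N(b (torusPart b)⁻¹) · w_T(torusPart b)`
(order `n · t`) is a covering weight of `B(F)_B` on `B(𝔸_F)`: `β ∈ B(F)` is uniquely `ν τ` (§3), and
`Σ_{β} w(β b) = Σ_τ w_T(τ t_b) · Σ_ν w_N(ν · τ n_b τ⁻¹) = Σ_τ w_T(τ t_b) = 1`.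
[cite: Arthur1978TraceFormulaI, §1] [cite: Rogawski1990, §2.2 (p. 13)] -/
theorem isCoveringWeight_borel_of_unipotent_of_torus {wN : unipotentInBorel F E c N → ℝ≥0∞}
    (hwN : IsCoveringWeight ((((quasiSplit F E c N).arithmeticSubgroup).subgroupOf (borelAdelic F E c N)).subgroupOf
      (unipotentInBorel F E c N)) wN)
    {wT : torusInBorel F E c N → ℝ≥0∞}
    (hwT : IsCoveringWeight ((((quasiSplit F E c N).arithmeticSubgroup).subgroupOf (borelAdelic F E c N)).subgroupOf
      (torusInBorel F E c N)) wT) :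
    IsCoveringWeight (((quasiSplit F E c N).arithmeticSubgroup).subgroupOf (borelAdelic F E c N))
      (fun b : borelAdelic F E c N =>
        wN ⟨b * (torusPart b)⁻¹, mul_torusPart_inv_mem_unipotentInBorel b⟩ *
          wT ⟨torusPart b, torusPart_mem_torusAdelic b⟩) := by
  refine ⟨(hwN.measurable.comp measurable_mul_torusPart_inv).mul (hwT.measurable.comp measurable_torusPart_mk),
    fun b => ?_⟩
  obtain ⟨e, he⟩ := exists_equiv_subgroupOf_torus_prod_unipotent (F := F) (E := E) (c := c) (N := N)
  -- abbreviations: the conjugated unipotent part and the torus part of `b`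
  set n' : torusInBorel F E c N → unipotentInBorel F E c N := fun τ =>
    ⟨(τ : borelAdelic F E c N) * (b * (torusPart b)⁻¹) * (τ : borelAdelic F E c N)⁻¹,
      mul_mul_inv_mem_unipotentInBorel _ (mul_torusPart_inv_mem_unipotentInBorel b)⟩ with hn'
  set t' : torusInBorel F E c N := ⟨torusPart b, torusPart_mem_torusAdelic b⟩ with ht'
  rw [coveringSum_apply]
  calc ∑' β : ((quasiSplit F E c N).arithmeticSubgroup).subgroupOf (borelAdelic F E c N),
        wN ⟨β • b * (torusPart (β • b))⁻¹, mul_torusPart_inv_mem_unipotentInBorel _⟩ *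
          wT ⟨torusPart (β • b), torusPart_mem_torusAdelic _⟩
      = ∑' p : (((quasiSplit F E c N).arithmeticSubgroup).subgroupOf (borelAdelic F E c N)).subgroupOf
              (torusInBorel F E c N) ×
            (((quasiSplit F E c N).arithmeticSubgroup).subgroupOf (borelAdelic F E c N)).subgroupOf
              (unipotentInBorel F E c N),
          wN ⟨e p • b * (torusPart (e p • b))⁻¹, mul_torusPart_inv_mem_unipotentInBorel _⟩ *
            wT ⟨torusPart (e p • b), torusPart_mem_torusAdelic _⟩ :=
        (Equiv.tsum_eq e (fun β : ((quasiSplit F E c N).arithmeticSubgroup).subgroupOf (borelAdelic F E c N) =>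
          wN ⟨β • b * (torusPart (β • b))⁻¹, mul_torusPart_inv_mem_unipotentInBorel _⟩ *
            wT ⟨torusPart (β • b), torusPart_mem_torusAdelic _⟩)).symm
    _ = ∑' p : (((quasiSplit F E c N).arithmeticSubgroup).subgroupOf (borelAdelic F E c N)).subgroupOf
              (torusInBorel F E c N) ×
            (((quasiSplit F E c N).arithmeticSubgroup).subgroupOf (borelAdelic F E c N)).subgroupOf
              (unipotentInBorel F E c N),
          wN (p.2 • n' (p.1 : torusInBorel F E c N)) * wT (p.1 • t') := by
        refine tsum_congr fun p => ?_
        have hsmul : e p • b = (((p.2 : unipotentInBorel F E c N) : borelAdelic F E c N)) *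
            ((p.1 : torusInBorel F E c N) : borelAdelic F E c N) * b := by
          rw [Subgroup.smul_def, smul_eq_mul, he p]
        simp only [hsmul]
        rw [productWeight_apply_unipotent_mul_torus_mul]
        rfl
    _ = ∑' (τ : (((quasiSplit F E c N).arithmeticSubgroup).subgroupOf (borelAdelic F E c N)).subgroupOf
              (torusInBorel F E c N))
          (ν : (((quasiSplit F E c N).arithmeticSubgroup).subgroupOf (borelAdelic F E c N)).subgroupOf
              (unipotentInBorel F E c N)),
          wN (ν • n' (τ : torusInBorel F E c N)) * wT (τ • t') :=
        ENNReal.tsum_prod (f := fun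
          (τ : (((quasiSplit F E c N).arithmeticSubgroup).subgroupOf (borelAdelic F E c N)).subgroupOf
            (torusInBorel F E c N))
          (ν : (((quasiSplit F E c N).arithmeticSubgroup).subgroupOf (borelAdelic F E c N)).subgroupOf
            (unipotentInBorel F E c N)) => wN (ν • n' (τ : torusInBorel F E c N)) * wT (τ • t'))
    _ = ∑' τ : (((quasiSplit F E c N).arithmeticSubgroup).subgroupOf (borelAdelic F E c N)).subgroupOf
              (torusInBorel F E c N),
          coveringSum ((((quasiSplit F E c N).arithmeticSubgroup).subgroupOf (borelAdelic F E c N)).subgroupOf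
              (unipotentInBorel F E c N)) wN (n' (τ : torusInBorel F E c N)) * wT (τ • t') := by
        refine tsum_congr fun τ => ?_
        rw [ENNReal.tsum_mul_right, coveringSum_apply]
    _ = ∑' τ : (((quasiSplit F E c N).arithmeticSubgroup).subgroupOf (borelAdelic F E c N)).subgroupOf
              (torusInBorel F E c N), wT (τ • t') := by
        refine tsum_congr fun τ => ?_
        rw [hwN.coveringSum_eq, one_mul]
    _ = 1 := by rw [← coveringSum_apply]; exact hwT.coveringSum_eq t'

/-- **The product weight with an indicator** (the letter of WORDS #2 (4)): for a STRICT measurable fundamental set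
`Ω ⊆ N(𝔸_F)` of `N(F)_N` and a covering weight `w_T` of `T(F)_T`, `b ↦ 1_Ω(b (torusPart b)⁻¹) · w_T(torusPart b)` is a
covering weight of `B(F)_B` on `B(𝔸_F)` (★ `isCoveringWeight_indicator` + the previous theorem).
[cite: Arthur1978TraceFormulaI, §1] -/
theorem isCoveringWeight_borel_indicator_mul {Ω : Set (unipotentInBorel F E c N)} (hΩ : MeasurableSet Ω)
    (hΩu : ∀ n : unipotentInBorel F E c N,
      ∃! ν : (((quasiSplit F E c N).arithmeticSubgroup).subgroupOf (borelAdelic F E c N)).subgroupOf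
        (unipotentInBorel F E c N), ν • n ∈ Ω)
    {wT : torusInBorel F E c N → ℝ≥0∞}
    (hwT : IsCoveringWeight ((((quasiSplit F E c N).arithmeticSubgroup).subgroupOf (borelAdelic F E c N)).subgroupOf
      (torusInBorel F E c N)) wT) :
    IsCoveringWeight (((quasiSplit F E c N).arithmeticSubgroup).subgroupOf (borelAdelic F E c N))
      (fun b : borelAdelic F E c N =>
        Ω.indicator (1 : unipotentInBorel F E c N → ℝ≥0∞) ⟨b * (torusPart b)⁻¹, mul_torusPart_inv_mem_unipotentInBorel b⟩ *
          wT ⟨torusPart b, torusPart_mem_torusAdelic b⟩) :=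
  isCoveringWeight_borel_of_unipotent_of_torus (isCoveringWeight_indicator hΩ hΩu) hwT

/-- **Existence of the whole package** `(Ω, w_T)`: a strict measurable fundamental set `Ω` of `N(F)_N` in `N(𝔸_F)`
and a covering weight `w_T` of `T(F)_T` on `T(𝔸_F)`, whose product `1_Ω(b (torusPart b)⁻¹) · w_T(torusPart b)` is then
a covering weight of `B(F)_B` on `B(𝔸_F)`. [cite: Arthur1978TraceFormulaI, §1] -/
theorem exists_isCoveringWeight_borel_indicator_mul :
    ∃ (Ω : Set (unipotentInBorel F E c N)) (wT : torusInBorel F E c N → ℝ≥0∞),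
      MeasurableSet Ω ∧
      (∀ n : unipotentInBorel F E c N,
        ∃! ν : (((quasiSplit F E c N).arithmeticSubgroup).subgroupOf (borelAdelic F E c N)).subgroupOf
          (unipotentInBorel F E c N), ν • n ∈ Ω) ∧
      IsCoveringWeight ((((quasiSplit F E c N).arithmeticSubgroup).subgroupOf (borelAdelic F E c N)).subgroupOf
        (torusInBorel F E c N)) wT ∧
      IsCoveringWeight (((quasiSplit F E c N).arithmeticSubgroup).subgroupOf (borelAdelic F E c N))
        (fun b : borelAdelic F E c N =>
          Ω.indicator (1 : unipotentInBorel F E c N → ℝ≥0∞) ⟨b * (torusPart b)⁻¹, mul_torusPart_inv_mem_unipotentInBorel b⟩ *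
            wT ⟨torusPart b, torusPart_mem_torusAdelic b⟩) := by
  obtain ⟨Ω, hΩ, hΩu⟩ := exists_measurableSet_existsUnique_smul_mem_unipotentInBorel (F := F) (E := E) (c := c) (N := N)
  obtain ⟨wT, hwT⟩ := exists_isCoveringWeight_torusInBorel (F := F) (E := E) (c := c) (N := N)
  exact ⟨Ω, wT, hΩ, hΩu, hwT, isCoveringWeight_borel_indicator_mul hΩ hΩu hwT⟩

end ProductWeight

end UnitaryGroup

end Literature.NumberTheory.Automorphic
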